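import Summits.Ventures.YMGap.RobustBall.OneStateStarSU3
import Summits.Ventures.YMGap.RobustBall.MassGapOnBallZdGRowsSU3PV
import Summits.Ventures.YMGap.RobustBall.AreaLawRowsSU3PV
import HarnessLib

/-!
# Venture YMGap, track ROBUST-BALL (Y2) — `SU(3)` HYPOTHESIS-FREE ONE-STATE cells on the Poincaré × Schwinger–Dyson star cells (`ℤ⁴`)

HONEST FRAMING. WHAT THIS IS: a venture file (cell `pub-ymgap`, track Y2 ROBUST-BALL, seat engine-2 (g9); 0 compute).  ds-3's one-state
composition `oneState_onBallZdG` (a `ℤ⁴` mass-gap cell × a torus area-law cell at the same loads ⇒ for every member of the gauge-invariant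
tier-1 ball: EXACTLY ONE DLR state = the infinite-volume limit of the member's PERIODISED torus states, massive, plaquette–plaquette decay,
Wilson area law with one `(C, c)` per range) applied to THIS SEAT's hypothesis-free `SU(3)` PV cells: the `ℤ⁴` star cells of
`MassGapOnBallZdGRowsSU3PV` (`su3_massGapOnBallZdG_pvStar_*`) × the PV pair-door area law `RobustBallPV.su3_areaLawOnBall_pv` at the same
`(β_W, 2ε, ε)` (the area-law radius at these couplings is ≥ `0.18`, far above the star `ε`).  Class K outright (no displayed hypothesis).
* schema `su3_oneState_of_pvStar_row`: a PV area-law certificate at `(β_W, ε)` + a `MassGapOnBallZdG 4 3 (β_W/9) (2ε) ε R` cell ⇒ one state;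
* cells `su3_oneState_pvStar_*` `(β_W, ε)`: (1 / 8, .150) (1 / 6, .114) (1 / 5, .087) (1 / 4, .049) (27 / 100, .034) (3 / 10, .013) (31 / 100, .005).
WHAT MOVES: ds-3's hypothesis-free `SU(3)` one-state cells (`OneStateStarSU3`, eigen modulus) were (1/8, .148) (1/6, .104) (1/5, .069) (1/4, .019);
every cell here is larger and the frontier moves `1/4 → 31/100`.  The one-state cells GIVEN H1, H2 (`OneStateStarSU3Certified`, to `11/20`) are
untouched.  NOT CLAIMED: existence of the string tension for a non-Wilson member (only `HasAreaLawWith μ χ C c`); a range-uniform `(C, c)`;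
anything at weak coupling, about the continuum limit or the Millennium problem.

References: ds-3's `RobustBall/OneState.lean`, `OneStateStarSU3.lean`; this seat's `MassGapOnBallZdGRowsSU3PV.lean`, `AreaLawRowsSU3PV.lean`,
`Thresholds/OneLinkVarianceSD.lean`.
-/

noncomputable section

open MeasureTheory Filter Topology Function Finset
open scoped NNReal
open Literature.Probability.LatticeModels
open Literature.MathematicalPhysics.QuantumLattice hiding torusNorm
open Literature.MathematicalPhysics.QuantumFieldTheory hiding ZdEdge Site
open Literature.Barriers.QuantumFields (IsMassiveState)
open Summit.Ventures.YMGap.RobustBallPV (su3_areaLawOnBall_pv)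

namespace Summit.Ventures.YMGap.RobustBall

/-- **SCHEMA, `SU(3)`, `ℤ⁴`, HYPOTHESIS-FREE one state on a PV star cell**: a PV pair-door area-law certificate at `(β_W, ε)` (radius
`R_al ≥ 2β_W/3`, envelope `q, p, K, s₀`, `T(2ε)(6(β_W/9)K) + T(ε)s₀ε < 1`) and a cell `MassGapOnBallZdG 4 3 (β_W/9) ε₀ ε R` with `ε₀ = 2ε` give ds-3's
five one-state clauses for every member of `MemBallZdG ε₀ ε R`. [folklore] -/
theorem su3_oneState_of_pvStar_row {βW ε₀ ε Ral q p K s₀ : ℝ} {R : ℕ} (h2 : 2 * ε = ε₀) (hε : 0 ≤ ε) (hβ0 : 0 ≤ βW)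
    (hR : βW / 9 * (2 * ((3 : ℕ) : ℝ)) ≤ Ral) (hR0 : 0 ≤ Ral) (hR2 : Ral < 1 / 2) (hq0 : 0 ≤ q) (hq : 1 + 9 * Ral ^ 2 / 4 ≤ q ^ 2)
    (hp0 : 0 ≤ p) (hp : 1 ≤ p ^ 2 * (1 / 2 - Ral)) (hK : (3 * Ral / 2 + q) * p ≤ K) (hs0 : 0 ≤ s₀)
    (hs : 1 ≤ 3 * s₀ ^ 2 * (1 / 2 - Ral)) (hε1 : ε ≤ 1 / 2)
    (hcert : (1 + 2 * ε + (2 * ε) ^ 2 / 2 + (2 * ε) ^ 3 / 6 + 5 / 96 * (2 * ε) ^ 4) * (2 * ((3 : ℕ) : ℝ) * (βW / 9) * K) +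
      (1 + ε + ε ^ 2 / 2 + ε ^ 3 / 6 + 5 / 96 * ε ^ 4) * s₀ * ε < 1)
    (hgap : MassGapOnBallZdG 4 3 (βW / 9) ε₀ ε R) :
    ∃ C c : ℝ, 0 < c ∧ ∀ (W : Potential (ZdEdge 4) (SUN 3)) (supp : Finset (ZdEdge 4) → Finset (Finset (ZdEdge 4)))
      (hmem : MemBallZdG ε₀ ε R W supp) (hdep : ∀ X, DependsOn (W X) (↑X : Set (ZdEdge 4)))
      (hg : ∀ X, IsZdGaugeInvariant (W X)) (hm : ∀ X, Measurable (W X)) (hb : ∀ X, ∃ C, ∀ U, |W X U| ≤ C),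
      ∃ μ : Measure (LGConfig 4 (SUN 3)),
        perturbedGibbsMeasures (d := 4) (fundamentalRep (Fin 3)) (((3 : ℕ) : ℝ) * (βW / 9)) W supp = {μ} ∧
        perturbedLimitPoints (((3 : ℕ) : ℝ) * (βW / 9)) (periodisedFamily W supp hdep hg hm hb) = {μ} ∧
        IsMassiveState μ ∧ HasExponentialDecay (plaquetteCorrFn (fundamentalRep (Fin 3)) μ) ∧
        HasAreaLawWith μ (fun g => normalisedCharacter 3 (fundamentalRep (Fin 3) g)) C c := by
  have hA := su3_areaLawOnBall_pv (n := 3) R (mv := 2 * R + 1) (by omega) hβ0 hR hR0 hR2 hq0 hq hp0 hp hK hs0 hs hε hε1 hcert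
  have e : βW / 3 = ((3 : ℕ) : ℝ) * (βW / 9) := by push_cast; ring
  rw [e, h2] at hA
  exact oneState_onBallZdG (N := 3) (by norm_num) (by linarith) hε hgap hA

/-! ### Cells by name (hypothesis-free) -/

/-- **`SU(3)`, `ℤ⁴`, `β_W = 1 / 8`, HYPOTHESIS-FREE**: every member of the gauge-invariant tier-1 ball `MemBallZdG (3 / 10) (3 / 20) R` added to
`SU(3)` Wilson at `β_W = 1 / 8` ('t Hooft `1 / 72`) has ONE state (unique DLR state = periodised-torus limit, massive, plaquette decay, area law;
one `(C, c)` per `R`) — `su3_massGapOnBallZdG_pvStar_oneEighth` × the PV area law at the same loads (certificate `K = 175491 / 100000`, `s₀ = 223607 / 250000`).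
[folklore] -/
theorem su3_oneState_pvStar_oneEighth (R : ℕ) :
    ∃ C c : ℝ, 0 < c ∧ ∀ (W : Potential (ZdEdge 4) (SUN 3)) (supp : Finset (ZdEdge 4) → Finset (Finset (ZdEdge 4)))
      (hmem : MemBallZdG (3 / 10) (3 / 20) R W supp) (hdep : ∀ X, DependsOn (W X) (↑X : Set (ZdEdge 4)))
      (hg : ∀ X, IsZdGaugeInvariant (W X)) (hm : ∀ X, Measurable (W X)) (hb : ∀ X, ∃ C, ∀ U, |W X U| ≤ C),
      ∃ μ : Measure (LGConfig 4 (SUN 3)),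
        perturbedGibbsMeasures (d := 4) (fundamentalRep (Fin 3)) (((3 : ℕ) : ℝ) * ((1 / 8 : ℝ) / 9)) W supp = {μ} ∧
        perturbedLimitPoints (((3 : ℕ) : ℝ) * ((1 / 8 : ℝ) / 9)) (periodisedFamily W supp hdep hg hm hb) = {μ} ∧
        IsMassiveState μ ∧ HasExponentialDecay (plaquetteCorrFn (fundamentalRep (Fin 3)) μ) ∧
        HasAreaLawWith μ (fun g => normalisedCharacter 3 (fundamentalRep (Fin 3) g)) C c := by
  have hgap : MassGapOnBallZdG 4 3 ((1 / 8 : ℝ) / 9) (3 / 10) (3 / 20) R := by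
    have h := su3_massGapOnBallZdG_pvStar_oneEighth R; norm_num at h ⊢; exact h
  exact su3_oneState_of_pvStar_row (Ral := 1 / 12) (q := 1007783 / 1000000) (p := 774597 / 500000) (K := 175491 / 100000) (s₀ := 223607 / 250000)
    (by norm_num) (by norm_num) (by norm_num) (by norm_num) (by norm_num) (by norm_num) (by norm_num) (by norm_num) (by norm_num) (by norm_num)
    (by norm_num) (by norm_num) (by norm_num) (by norm_num) (by norm_num) hgap

/-- **`SU(3)`, `ℤ⁴`, `β_W = 1 / 6`, HYPOTHESIS-FREE**: every member of the gauge-invariant tier-1 ball `MemBallZdG (57 / 250) (57 / 500) R` added to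
`SU(3)` Wilson at `β_W = 1 / 6` ('t Hooft `1 / 54`) has ONE state (unique DLR state = periodised-torus limit, massive, plaquette decay, area law;
one `(C, c)` per `R`) — `su3_massGapOnBallZdG_pvStar_oneSixth` × the PV area law at the same loads (certificate `K = 37859 / 20000`, `s₀ = 925821 / 1000000`).
[folklore] -/
theorem su3_oneState_pvStar_oneSixth (R : ℕ) :
    ∃ C c : ℝ, 0 < c ∧ ∀ (W : Potential (ZdEdge 4) (SUN 3)) (supp : Finset (ZdEdge 4) → Finset (Finset (ZdEdge 4)))
      (hmem : MemBallZdG (57 / 250) (57 / 500) R W supp) (hdep : ∀ X, DependsOn (W X) (↑X : Set (ZdEdge 4)))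
      (hg : ∀ X, IsZdGaugeInvariant (W X)) (hm : ∀ X, Measurable (W X)) (hb : ∀ X, ∃ C, ∀ U, |W X U| ≤ C),
      ∃ μ : Measure (LGConfig 4 (SUN 3)),
        perturbedGibbsMeasures (d := 4) (fundamentalRep (Fin 3)) (((3 : ℕ) : ℝ) * ((1 / 6 : ℝ) / 9)) W supp = {μ} ∧
        perturbedLimitPoints (((3 : ℕ) : ℝ) * ((1 / 6 : ℝ) / 9)) (periodisedFamily W supp hdep hg hm hb) = {μ} ∧
        IsMassiveState μ ∧ HasExponentialDecay (plaquetteCorrFn (fundamentalRep (Fin 3)) μ) ∧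
        HasAreaLawWith μ (fun g => normalisedCharacter 3 (fundamentalRep (Fin 3) g)) C c := by
  have hgap : MassGapOnBallZdG 4 3 ((1 / 6 : ℝ) / 9) (57 / 250) (57 / 500) R := by
    have h := su3_massGapOnBallZdG_pvStar_oneSixth R; norm_num at h ⊢; exact h
  exact su3_oneState_of_pvStar_row (Ral := 1 / 9) (q := 506897 / 500000) (p := 100223 / 62500) (K := 37859 / 20000) (s₀ := 925821 / 1000000)
    (by norm_num) (by norm_num) (by norm_num) (by norm_num) (by norm_num) (by norm_num) (by norm_num) (by norm_num) (by norm_num) (by norm_num)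
    (by norm_num) (by norm_num) (by norm_num) (by norm_num) (by norm_num) hgap

/-- **`SU(3)`, `ℤ⁴`, `β_W = 1 / 5`, HYPOTHESIS-FREE**: every member of the gauge-invariant tier-1 ball `MemBallZdG (87 / 500) (87 / 1000) R` added to
`SU(3)` Wilson at `β_W = 1 / 5` ('t Hooft `1 / 45`) has ONE state (unique DLR state = periodised-torus limit, massive, plaquette decay, area law;
one `(C, c)` per `R`) — `su3_massGapOnBallZdG_pvStar_oneFifth` × the PV area law at the same loads (certificate `K = 40289 / 20000`, `s₀ = 953463 / 1000000`).
[folklore] -/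
theorem su3_oneState_pvStar_oneFifth (R : ℕ) :
    ∃ C c : ℝ, 0 < c ∧ ∀ (W : Potential (ZdEdge 4) (SUN 3)) (supp : Finset (ZdEdge 4) → Finset (Finset (ZdEdge 4)))
      (hmem : MemBallZdG (87 / 500) (87 / 1000) R W supp) (hdep : ∀ X, DependsOn (W X) (↑X : Set (ZdEdge 4)))
      (hg : ∀ X, IsZdGaugeInvariant (W X)) (hm : ∀ X, Measurable (W X)) (hb : ∀ X, ∃ C, ∀ U, |W X U| ≤ C),
      ∃ μ : Measure (LGConfig 4 (SUN 3)),
        perturbedGibbsMeasures (d := 4) (fundamentalRep (Fin 3)) (((3 : ℕ) : ℝ) * ((1 / 5 : ℝ) / 9)) W supp = {μ} ∧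
        perturbedLimitPoints (((3 : ℕ) : ℝ) * ((1 / 5 : ℝ) / 9)) (periodisedFamily W supp hdep hg hm hb) = {μ} ∧
        IsMassiveState μ ∧ HasExponentialDecay (plaquetteCorrFn (fundamentalRep (Fin 3)) μ) ∧
        HasAreaLawWith μ (fun g => normalisedCharacter 3 (fundamentalRep (Fin 3) g)) C c := by
  have hgap : MassGapOnBallZdG 4 3 ((1 / 5 : ℝ) / 9) (87 / 500) (87 / 1000) R := by
    have h := su3_massGapOnBallZdG_pvStar_oneFifth R; norm_num at h ⊢; exact h
  exact su3_oneState_of_pvStar_row (Ral := 2 / 15) (q := 254951 / 250000) (p := 825723 / 500000) (K := 40289 / 20000) (s₀ := 953463 / 1000000)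
    (by norm_num) (by norm_num) (by norm_num) (by norm_num) (by norm_num) (by norm_num) (by norm_num) (by norm_num) (by norm_num) (by norm_num)
    (by norm_num) (by norm_num) (by norm_num) (by norm_num) (by norm_num) hgap

/-- **`SU(3)`, `ℤ⁴`, `β_W = 1 / 4`, HYPOTHESIS-FREE**: every member of the gauge-invariant tier-1 ball `MemBallZdG (49 / 500) (49 / 1000) R` added to
`SU(3)` Wilson at `β_W = 1 / 4` ('t Hooft `1 / 36`) has ONE state (unique DLR state = periodised-torus limit, massive, plaquette decay, area law;
one `(C, c)` per `R`) — `su3_massGapOnBallZdG_pvStar_oneQuarter` × the PV area law at the same loads (certificate `K = 110919 / 50000`, `s₀ = 1`).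
[folklore] -/
theorem su3_oneState_pvStar_oneQuarter (R : ℕ) :
    ∃ C c : ℝ, 0 < c ∧ ∀ (W : Potential (ZdEdge 4) (SUN 3)) (supp : Finset (ZdEdge 4) → Finset (Finset (ZdEdge 4)))
      (hmem : MemBallZdG (49 / 500) (49 / 1000) R W supp) (hdep : ∀ X, DependsOn (W X) (↑X : Set (ZdEdge 4)))
      (hg : ∀ X, IsZdGaugeInvariant (W X)) (hm : ∀ X, Measurable (W X)) (hb : ∀ X, ∃ C, ∀ U, |W X U| ≤ C),
      ∃ μ : Measure (LGConfig 4 (SUN 3)),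
        perturbedGibbsMeasures (d := 4) (fundamentalRep (Fin 3)) (((3 : ℕ) : ℝ) * ((1 / 4 : ℝ) / 9)) W supp = {μ} ∧
        perturbedLimitPoints (((3 : ℕ) : ℝ) * ((1 / 4 : ℝ) / 9)) (periodisedFamily W supp hdep hg hm hb) = {μ} ∧
        IsMassiveState μ ∧ HasExponentialDecay (plaquetteCorrFn (fundamentalRep (Fin 3)) μ) ∧
        HasAreaLawWith μ (fun g => normalisedCharacter 3 (fundamentalRep (Fin 3) g)) C c := by
  have hgap : MassGapOnBallZdG 4 3 ((1 / 4 : ℝ) / 9) (49 / 500) (49 / 1000) R := by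
    have h := su3_massGapOnBallZdG_pvStar_oneQuarter R; norm_num at h ⊢; exact h
  exact su3_oneState_of_pvStar_row (Ral := 1 / 6) (q := 1030777 / 1000000) (p := 1732051 / 1000000) (K := 110919 / 50000) (s₀ := 1)
    (by norm_num) (by norm_num) (by norm_num) (by norm_num) (by norm_num) (by norm_num) (by norm_num) (by norm_num) (by norm_num) (by norm_num)
    (by norm_num) (by norm_num) (by norm_num) (by norm_num) (by norm_num) hgap

/-- **`SU(3)`, `ℤ⁴`, `β_W = 27 / 100`, HYPOTHESIS-FREE**: every member of the gauge-invariant tier-1 ball `MemBallZdG (17 / 250) (17 / 500) R` added to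
`SU(3)` Wilson at `β_W = 27 / 100` ('t Hooft `3 / 100`) has ONE state (unique DLR state = periodised-torus limit, massive, plaquette decay, area law;
one `(C, c)` per `R`) — `su3_massGapOnBallZdG_pvStar_twentySevenHundredths` × the PV area law at the same loads (certificate `K = 230837 / 100000`, `s₀ = 1020621 / 1000000`).
[folklore] -/
theorem su3_oneState_pvStar_twentySevenHundredths (R : ℕ) :
    ∃ C c : ℝ, 0 < c ∧ ∀ (W : Potential (ZdEdge 4) (SUN 3)) (supp : Finset (ZdEdge 4) → Finset (Finset (ZdEdge 4)))
      (hmem : MemBallZdG (17 / 250) (17 / 500) R W supp) (hdep : ∀ X, DependsOn (W X) (↑X : Set (ZdEdge 4)))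
      (hg : ∀ X, IsZdGaugeInvariant (W X)) (hm : ∀ X, Measurable (W X)) (hb : ∀ X, ∃ C, ∀ U, |W X U| ≤ C),
      ∃ μ : Measure (LGConfig 4 (SUN 3)),
        perturbedGibbsMeasures (d := 4) (fundamentalRep (Fin 3)) (((3 : ℕ) : ℝ) * ((27 / 100 : ℝ) / 9)) W supp = {μ} ∧
        perturbedLimitPoints (((3 : ℕ) : ℝ) * ((27 / 100 : ℝ) / 9)) (periodisedFamily W supp hdep hg hm hb) = {μ} ∧
        IsMassiveState μ ∧ HasExponentialDecay (plaquetteCorrFn (fundamentalRep (Fin 3)) μ) ∧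
        HasAreaLawWith μ (fun g => normalisedCharacter 3 (fundamentalRep (Fin 3) g)) C c := by
  have hgap : MassGapOnBallZdG 4 3 ((27 / 100 : ℝ) / 9) (17 / 250) (17 / 500) R := by
    have h := su3_massGapOnBallZdG_pvStar_twentySevenHundredths R; norm_num at h ⊢; exact h
  exact su3_oneState_of_pvStar_row (Ral := 9 / 50) (q := 1035809 / 1000000) (p := 1767767 / 1000000) (K := 230837 / 100000) (s₀ := 1020621 / 1000000)
    (by norm_num) (by norm_num) (by norm_num) (by norm_num) (by norm_num) (by norm_num) (by norm_num) (by norm_num) (by norm_num) (by norm_num)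
    (by norm_num) (by norm_num) (by norm_num) (by norm_num) (by norm_num) hgap

/-- **`SU(3)`, `ℤ⁴`, `β_W = 3 / 10`, HYPOTHESIS-FREE**: every member of the gauge-invariant tier-1 ball `MemBallZdG (13 / 500) (13 / 1000) R` added to
`SU(3)` Wilson at `β_W = 3 / 10` ('t Hooft `1 / 30`) has ONE state (unique DLR state = periodised-torus limit, massive, plaquette decay, area law;
one `(C, c)` per `R`) — `su3_massGapOnBallZdG_pvStar_threeTenths` × the PV area law at the same loads (certificate `K = 122693 / 50000`, `s₀ = 1054093 / 1000000`).
[folklore] -/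
theorem su3_oneState_pvStar_threeTenths (R : ℕ) :
    ∃ C c : ℝ, 0 < c ∧ ∀ (W : Potential (ZdEdge 4) (SUN 3)) (supp : Finset (ZdEdge 4) → Finset (Finset (ZdEdge 4)))
      (hmem : MemBallZdG (13 / 500) (13 / 1000) R W supp) (hdep : ∀ X, DependsOn (W X) (↑X : Set (ZdEdge 4)))
      (hg : ∀ X, IsZdGaugeInvariant (W X)) (hm : ∀ X, Measurable (W X)) (hb : ∀ X, ∃ C, ∀ U, |W X U| ≤ C),
      ∃ μ : Measure (LGConfig 4 (SUN 3)),
        perturbedGibbsMeasures (d := 4) (fundamentalRep (Fin 3)) (((3 : ℕ) : ℝ) * ((3 / 10 : ℝ) / 9)) W supp = {μ} ∧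
        perturbedLimitPoints (((3 : ℕ) : ℝ) * ((3 / 10 : ℝ) / 9)) (periodisedFamily W supp hdep hg hm hb) = {μ} ∧
        IsMassiveState μ ∧ HasExponentialDecay (plaquetteCorrFn (fundamentalRep (Fin 3)) μ) ∧
        HasAreaLawWith μ (fun g => normalisedCharacter 3 (fundamentalRep (Fin 3) g)) C c := by
  have hgap : MassGapOnBallZdG 4 3 ((3 / 10 : ℝ) / 9) (13 / 500) (13 / 1000) R := by
    have h := su3_massGapOnBallZdG_pvStar_threeTenths R; norm_num at h ⊢; exact h
  exact su3_oneState_of_pvStar_row (Ral := 1 / 5) (q := 1044031 / 1000000) (p := 912871 / 500000) (K := 122693 / 50000) (s₀ := 1054093 / 1000000)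
    (by norm_num) (by norm_num) (by norm_num) (by norm_num) (by norm_num) (by norm_num) (by norm_num) (by norm_num) (by norm_num) (by norm_num)
    (by norm_num) (by norm_num) (by norm_num) (by norm_num) (by norm_num) hgap

/-- **`SU(3)`, `ℤ⁴`, `β_W = 31 / 100`, HYPOTHESIS-FREE**: every member of the gauge-invariant tier-1 ball `MemBallZdG (1 / 100) (1 / 200) R` added to
`SU(3)` Wilson at `β_W = 31 / 100` ('t Hooft `31 / 900`) has ONE state (unique DLR state = periodised-torus limit, massive, plaquette decay, area law;
one `(C, c)` per `R`) — `su3_massGapOnBallZdG_pvStar_thirtyOneHundredths` × the PV area law at the same loads (certificate `K = 15659 / 6250`, `s₀ = 266501 / 250000`).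
[folklore] -/
theorem su3_oneState_pvStar_thirtyOneHundredths (R : ℕ) :
    ∃ C c : ℝ, 0 < c ∧ ∀ (W : Potential (ZdEdge 4) (SUN 3)) (supp : Finset (ZdEdge 4) → Finset (Finset (ZdEdge 4)))
      (hmem : MemBallZdG (1 / 100) (1 / 200) R W supp) (hdep : ∀ X, DependsOn (W X) (↑X : Set (ZdEdge 4)))
      (hg : ∀ X, IsZdGaugeInvariant (W X)) (hm : ∀ X, Measurable (W X)) (hb : ∀ X, ∃ C, ∀ U, |W X U| ≤ C),
      ∃ μ : Measure (LGConfig 4 (SUN 3)),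
        perturbedGibbsMeasures (d := 4) (fundamentalRep (Fin 3)) (((3 : ℕ) : ℝ) * ((31 / 100 : ℝ) / 9)) W supp = {μ} ∧
        perturbedLimitPoints (((3 : ℕ) : ℝ) * ((31 / 100 : ℝ) / 9)) (periodisedFamily W supp hdep hg hm hb) = {μ} ∧
        IsMassiveState μ ∧ HasExponentialDecay (plaquetteCorrFn (fundamentalRep (Fin 3)) μ) ∧
        HasAreaLawWith μ (fun g => normalisedCharacter 3 (fundamentalRep (Fin 3) g)) C c := by
  have hgap : MassGapOnBallZdG 4 3 ((31 / 100 : ℝ) / 9) (1 / 100) (1 / 200) R := by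
    have h := su3_massGapOnBallZdG_pvStar_thirtyOneHundredths R; norm_num at h ⊢; exact h
  exact su3_oneState_of_pvStar_row (Ral := 31 / 150) (q := 261737 / 250000) (p := 1846373 / 1000000) (K := 15659 / 6250) (s₀ := 266501 / 250000)
    (by norm_num) (by norm_num) (by norm_num) (by norm_num) (by norm_num) (by norm_num) (by norm_num) (by norm_num) (by norm_num) (by norm_num)
    (by norm_num) (by norm_num) (by norm_num) (by norm_num) (by norm_num) hgap

end Summit.Ventures.YMGap.RobustBall

end
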